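import Summits.HodgeConjecture.HodgeConjecture.Theses.CurveNetMordellWeil
import Literature.AlgebraicGeometry.Motives.CurveNet
import Literature.AlgebraicGeometry.Motives.ComplexPointsEhresmann
import Literature.AlgebraicGeometry.Motives.ComplexPointsManifold
import Literature.AlgebraicGeometry.HodgeTheory.ComplexGysin
import Literature.AlgebraicGeometry.HodgeTheory.GysinBaseChangeOfKunneth
import Literature.AlgebraicGeometry.HodgeTheory.HodgeTypePullback
import Literature.NumberTheory.Transcendental.Analytification
import Literature.NumberTheory.Transcendental.AnalytificationConnected
import Summits.HodgeConjecture.HodgeConjecture.Theorems.CurveNetMordellWeilCurveNetExistsLocalDegree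
import HarnessLib

/-!
# The cohomological transfer along the blow-down of a curve net:
`σ_* σ^* = t • id` with `t ≠ 0`, and Hodge classes of `X` are `σ_*` of Hodge classes of `X̃`

Helper file for the support item `CurveNetExists` (stmt-HodgeConjecture-2788) of route
`Summits/HodgeConjecture/HodgeConjecture/Theses/CurveNetMordellWeil`. For a curve net
`N : Motives.CurveNet m X` on a smooth projective complex `X` of dimension `m + 1` (total space
`X̃ = N.total`, blow-down `σ = N.blowDown : X̃ ⟶ X`, an isomorphism over the complement of the base
locus `F ⊊ X`) and any orientation family `μ`, ALL PROVED:

* `exists_homeomorph_offBaseLocus` — over `X ∖ F`, `σ(ℂ)` is a homeomorphism between the open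
  subsets `σ⁻¹(X ∖ F)(ℂ) ⊆ X̃(ℂ)` and `(X ∖ F)(ℂ) ⊆ X(ℂ)` (open immersions give open embeddings
  of complex points, SGA1 XII Prop. 3.1 (xi), the tree's `isOpenEmbedding_map_holds`), the former
  is non-empty, and `σ(ℂ)` is injective over it;
* `map_blowDown_fundamentalClass_ne_zero` — `σ(ℂ)_* [X̃(ℂ)]_μ ≠ 0` in `H_{2n}(X(ℂ); ℂ)` (the
  topological helper `map_fundamentalClass_ne_zero_of_homeomorph_nhds`: a map which is a
  homeomorphism near a point with one-point fibre pushes the fundamental class to a non-zero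
  class; Hatcher Thm. 3.26, Prop. 2.30);
* `complexGysin_blowDown_one_ne_zero`, `exists_complexGysin_blowDown_map_eq_smul` — `σ_* 1 ≠ 0`,
  hence `σ_* 1 = t • 1` with `t ≠ 0` (`H⁰(X(ℂ); ℂ) = ℂ • 1`, `X(ℂ)` connected), and by the
  projection formula (Fulton, *Young Tableaux*, App. B (6), the tree's `complexGysin_cup`)
  `σ_* (σ^* c) = c ∪ σ_* 1 = t • c` for every class `c` of `X`;
* `span_hodgeClasses_le_map_complexGysin_blowDown` — given a Hodge model of `X̃`, the `ℂ`-span of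
  the rational `(q,q)`-classes of `X` lies in `σ_*` of the `ℂ`-span of the rational `(q,q)`-classes
  of `X̃`: `c = σ_* (t⁻¹ • σ^* c)` and `σ^* c` is rational (`IsRationalClass.pullback`) of type
  `(q,q)` (Voisin I §7.3.2, the tree's `IsOfHodgeType.map_of_le`, same dimension).

The last statement is the cohomological half of `CurveNetExists`; the geometric half (existence of
a curve net) and the Hodge model of `X̃` (the route's own item `HodgeModels`) are its remaining
inputs (file `CurveNetMordellWeilCurveNetExists`).

## References

* [FultonYoungTableaux1997] W. Fulton, Young Tableaux, CUP 1997, App. B §B.1 (5)–(6).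
* [HatcherAT2002] A. Hatcher, Algebraic Topology, CUP 2002, §2.2 Prop. 2.30, §3.3 Thm. 3.26.
* [VoisinHodgeI2002] C. Voisin, Hodge Theory and Complex Algebraic Geometry I, CUP 2002, §7.3.2.
* [SGA1] A. Grothendieck, M. Raynaud, SGA 1, Exp. XII Prop. 3.1 (xi).
-/

noncomputable section

open CategoryTheory AlgebraicGeometry Set Topology
open Literature.AlgebraicGeometry Literature.AlgebraicGeometry.Motives
open Literature.AlgebraicGeometry.HodgeTheory
open Literature.AlgebraicTopology.SingularHomology

-- `Summit.HodgeConjecture.HodgeConjecture.Theorems` is the mandated namespace (single-conjunct summit: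
-- Sub = Summit), which `linter.dupNamespace` flags on every declaration; the lakefile turns the
-- linter off tree-wide (weak option), restated here so stand-alone elaboration is warning-free too.
set_option linter.dupNamespace false

namespace Summit.HodgeConjecture.HodgeConjecture.Theorems

variable {m : ℕ} {X : SchemeOver ℂ}

/-! ### The blow-down is a homeomorphism of complex points over the complement of the base locus -/

/-- **Over `X ∖ F` the blow-down is a homeomorphism of complex points.** For a curve net `N` on a
smooth projective `X` there are open subsets `V ⊆ X̃(ℂ)` (the complex points over
`σ⁻¹(X ∖ F)`, non-empty) and `W ⊆ X(ℂ)` (the complex points over `X ∖ F`) and a homeomorphism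
`e : V ≃ₜ W` which is the restriction of `σ(ℂ)`, and `σ(ℂ)` does not identify a point of `V` with
any other point of `X̃(ℂ)`. (The scheme isomorphism `σ⁻¹(X ∖ F) ⥲ X ∖ F` of the structure
`CurveNet`, transported to complex points: open immersions induce open embeddings,
SGA1 XII Prop. 3.1 (xi).) [cite: SGA1, Exp. XII Prop. 3.1 (xi)] -/
theorem exists_homeomorph_offBaseLocus (N : CurveNet m X) (hX : IsSmoothProjective (m + 1) X) :
    ∃ (V : Set (ComplexPoints N.total)) (W : Set (ComplexPoints X)) (e : V ≃ₜ W),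
      IsOpen V ∧ IsOpen W ∧ V.Nonempty ∧
      (∀ v : V, ((e v : W) : ComplexPoints X) = AlgPoints.map N.blowDown (v : ComplexPoints N.total)) ∧
      ∀ (v : V) (P : ComplexPoints N.total),
        AlgPoints.map N.blowDown P = AlgPoints.map N.blowDown (v : ComplexPoints N.total) →
          P = (v : ComplexPoints N.total) := by
  haveI : IsSeparated X.hom := by
    haveI : IsProper X.hom := hX.isProjectiveOver.isProper
    infer_instance
  haveI : IrreducibleSpace X.left :=
    haveI := hX.geometricallyIrreducible
    GeometricallyIrreducible.irreducibleSpace_of_subsingleton X.hom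
  -- the open pieces `U = X ∖ F ⊆ X` and `Ũ = σ⁻¹ U ⊆ X̃` as `ℂ`-schemes, the open immersions
  let XU : SchemeOver ℂ := openSubschemeOver X N.offBaseLocus
  let XUt : SchemeOver ℂ := openSubschemeOver N.total (N.blowDown.left ⁻¹ᵁ N.offBaseLocus)
  obtain ⟨ιU, hιU⟩ : ∃ ι : XU ⟶ X, ι.left = N.offBaseLocus.ι := ⟨openSubschemeOverι X _, rfl⟩
  obtain ⟨ιUt, hιUt⟩ : ∃ ι : XUt ⟶ N.total, ι.left = (N.blowDown.left ⁻¹ᵁ N.offBaseLocus).ι :=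
    ⟨openSubschemeOverι N.total _, rfl⟩
  haveI : IsOpenImmersion ιU.left := by
    rw [hιU]; exact (inferInstance : IsOpenImmersion N.offBaseLocus.ι)
  haveI : IsOpenImmersion ιUt.left := by
    rw [hιUt]; exact (inferInstance : IsOpenImmersion (N.blowDown.left ⁻¹ᵁ N.offBaseLocus).ι)
  -- the scheme isomorphism `σ ∣_ U : Ũ ⥲ U` (field `isIso_blowDown_restrict`) and its inverse, over `ℂ`
  obtain ⟨σU, hσU⟩ : ∃ φ : XUt ⟶ XU, φ.left = N.blowDown.left ∣_ N.offBaseLocus :=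
    ⟨Over.homMk (N.blowDown.left ∣_ N.offBaseLocus) (by
      change (N.blowDown.left ∣_ N.offBaseLocus) ≫ N.offBaseLocus.ι ≫ X.hom =
        (N.blowDown.left ⁻¹ᵁ N.offBaseLocus).ι ≫ N.total.hom
      rw [← Category.assoc, morphismRestrict_ι, Category.assoc, Over.w N.blowDown]), rfl⟩
  obtain ⟨τU, hτU⟩ : ∃ φ : XU ⟶ XUt, φ.left = inv (N.blowDown.left ∣_ N.offBaseLocus) :=
    ⟨Over.homMk (show ((N.offBaseLocus : X.left.Opens) : Scheme) ⟶
          ((N.blowDown.left ⁻¹ᵁ N.offBaseLocus : N.total.left.Opens) : Scheme) from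
        inv (N.blowDown.left ∣_ N.offBaseLocus)) (by
      change inv (N.blowDown.left ∣_ N.offBaseLocus) ≫
          (N.blowDown.left ⁻¹ᵁ N.offBaseLocus).ι ≫ N.total.hom = N.offBaseLocus.ι ≫ X.hom
      rw [IsIso.inv_comp_eq, ← Category.assoc, morphismRestrict_ι, Category.assoc,
        Over.w N.blowDown]), rfl⟩
  have hστ : σU ≫ τU = 𝟙 XUt := by
    ext : 1
    rw [Over.comp_left, hσU, hτU, Over.id_left]
    exact IsIso.hom_inv_id (N.blowDown.left ∣_ N.offBaseLocus)
  have hτσ : τU ≫ σU = 𝟙 XU := by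
    ext : 1
    rw [Over.comp_left, hσU, hτU, Over.id_left]
    exact IsIso.inv_hom_id (N.blowDown.left ∣_ N.offBaseLocus)
  have heU : σU ≫ ιU = ιUt ≫ N.blowDown := by
    ext : 1
    rw [Over.comp_left, Over.comp_left, hσU, hιU, hιUt]
    exact morphismRestrict_ι N.blowDown.left N.offBaseLocus
  -- complex points: the homeomorphism `XUt(ℂ) ≃ₜ XU(ℂ)`
  let e₀ : ComplexPoints XUt ≃ₜ ComplexPoints XU :=
    { toFun := AlgPoints.map σU
      invFun := AlgPoints.map τU
      left_inv := fun P ↦ by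
        rw [← AlgPoints.map_comp_apply, hστ, AlgPoints.map_id_apply]
      right_inv := fun Q ↦ by
        rw [← AlgPoints.map_comp_apply, hτσ, AlgPoints.map_id_apply]
      continuous_toFun := AlgPoints.continuous_map σU
      continuous_invFun := AlgPoints.continuous_map τU }
  have he₀ : ∀ P, e₀ P = AlgPoints.map σU P := fun P ↦ rfl
  -- the open embeddings `XUt(ℂ) ↪ X̃(ℂ)`, `XU(ℂ) ↪ X(ℂ)` and their ranges
  have hembt : IsEmbedding (AlgPoints.map ιUt : ComplexPoints XUt → ComplexPoints N.total) :=
    AlgPoints.isEmbedding_map ιUt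
  have hemb : IsEmbedding (AlgPoints.map ιU : ComplexPoints XU → ComplexPoints X) :=
    AlgPoints.isEmbedding_map ιU
  have hVt : Set.range (AlgPoints.map ιUt : ComplexPoints XUt → ComplexPoints N.total) =
      {P | P.pt ∈ N.blowDown.left ⁻¹ᵁ N.offBaseLocus} := by
    rw [AlgPoints.range_map_of_isOpenImmersion_holds ιUt]
    ext P
    change P.pt ∈ Set.range ιUt.left ↔ P.pt ∈ N.blowDown.left ⁻¹ᵁ N.offBaseLocus
    rw [hιUt]
    exact Set.ext_iff.1 (Scheme.Opens.range_ι (N.blowDown.left ⁻¹ᵁ N.offBaseLocus)) P.pt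
  refine ⟨Set.range (AlgPoints.map ιUt), Set.range (AlgPoints.map ιU),
    (hembt.toHomeomorph.symm.trans e₀).trans hemb.toHomeomorph,
    AlgPoints.isOpen_range_map ιUt, AlgPoints.isOpen_range_map ιU, ?_, ?_, ?_⟩
  · -- `σ⁻¹(X ∖ F)` has a complex point: it is a non-empty open subscheme of `X̃`
    obtain ⟨u, hu⟩ := N.offBaseLocus_nonempty
    obtain ⟨y, hy⟩ := N.surjective_blowDown u
    have hne : ((N.blowDown.left ⁻¹ᵁ N.offBaseLocus : N.total.left.Opens) : Set N.total.left).Nonempty :=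
      ⟨y, show N.blowDown.left.base y ∈ (N.offBaseLocus : Set X.left) by rw [hy]; exact hu⟩
    haveI : LocallyOfFiniteType N.total.hom := by
      haveI := N.smooth_total_hom
      infer_instance
    obtain ⟨P, hP⟩ := ComplexPoints.exists_pt_mem (X := N.total) hne
      (N.blowDown.left ⁻¹ᵁ N.offBaseLocus).isOpen.isLocallyClosed
    refine ⟨P, ?_⟩
    rw [hVt]
    exact hP
  · -- `e` is the restriction of `σ(ℂ)`
    rintro ⟨v, hv⟩
    obtain ⟨p, rfl⟩ := hv
    have h1 : hembt.toHomeomorph.symm ⟨AlgPoints.map ιUt p, ⟨p, rfl⟩⟩ = p := by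
      rw [Homeomorph.symm_apply_eq]
      ext : 1
      rfl
    change (AlgPoints.map ιU (e₀ (hembt.toHomeomorph.symm ⟨AlgPoints.map ιUt p, ⟨p, rfl⟩⟩)) :
      ComplexPoints X) = AlgPoints.map N.blowDown (AlgPoints.map ιUt p)
    rw [h1, he₀, ← AlgPoints.map_comp_apply, heU, AlgPoints.map_comp_apply]
  · -- `σ(ℂ)` does not identify a point over `σ⁻¹(X ∖ F)` with another point
    rintro ⟨v, hv⟩ P hP
    obtain ⟨p, rfl⟩ := hv
    have hPt : P.pt ∈ N.blowDown.left ⁻¹ᵁ N.offBaseLocus := by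
      have h1 : (AlgPoints.map N.blowDown P).pt =
          (AlgPoints.map N.blowDown (AlgPoints.map ιUt p)).pt := by rw [hP]
      rw [AlgPoints.pt_map, AlgPoints.pt_map] at h1
      have h2 : (AlgPoints.map ιUt p).pt ∈ N.blowDown.left ⁻¹ᵁ N.offBaseLocus := by
        have h3 : AlgPoints.map ιUt p ∈ Set.range (AlgPoints.map ιUt) := ⟨p, rfl⟩
        rw [hVt] at h3
        exact h3
      change N.blowDown.left.base P.pt ∈ (N.offBaseLocus : Set X.left)
      change N.blowDown.left.base (AlgPoints.map ιUt p).pt ∈ (N.offBaseLocus : Set X.left) at h2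
      change N.blowDown.left.base P.pt = N.blowDown.left.base (AlgPoints.map ιUt p).pt at h1
      rw [h1]
      exact h2
    have hPV : P ∈ Set.range (AlgPoints.map ιUt : ComplexPoints XUt → ComplexPoints N.total) := by
      rw [hVt]; exact hPt
    obtain ⟨p', rfl⟩ := hPV
    rw [← AlgPoints.map_comp_apply, ← AlgPoints.map_comp_apply, ← heU, AlgPoints.map_comp_apply,
      AlgPoints.map_comp_apply] at hP
    have h3 : AlgPoints.map σU p' = AlgPoints.map σU p := hemb.injective hP
    have h4 : p' = p := e₀.injective h3
    rw [h4]

/-! ### The degree of the blow-down is not zero -/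

/-- **`σ(ℂ)_* [X̃(ℂ)]_μ ≠ 0` in `H_{2n}(X(ℂ); ℂ)`** for the blow-down `σ` of a curve net on a smooth
projective `X` of dimension `n = m + 1` and any orientation family `μ`: `σ(ℂ)` is a homeomorphism
near a point over `X ∖ F` with one-point fibre (`exists_homeomorph_offBaseLocus`), so the
topological helper `map_fundamentalClass_ne_zero_of_homeomorph_nhds` applies to the closed
`2n`-manifold `X̃(ℂ)` (GAGA charts, compact, Hausdorff). [cite: HatcherAT2002, §3.3 Thm. 3.26(a) and §2.2 Prop. 2.30] -/
theorem map_blowDown_fundamentalClass_ne_zero (N : CurveNet m X) (hX : IsSmoothProjective (m + 1) X)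
    (μ : OrientationFamily) :
    singularHomology.map ℂ ℂ (AlgPoints.mapContinuous (L := ℂ) N.blowDown) (2 * (m + 1))
      (μ N.isSmoothProjective_total).fundamentalClass ≠ 0 := by
  obtain ⟨V, W, e, hV, hW, ⟨x, hx⟩, he, hinj⟩ := exists_homeomorph_offBaseLocus N hX
  letI := N.isSmoothProjective_total.chartedSpace
  haveI := ComplexPoints.compactSpace_of_isSmoothProjective N.isSmoothProjective_total
  haveI := ComplexPoints.t2Space_of_isSmoothProjective N.isSmoothProjective_total
  haveI := ComplexPoints.t2Space_of_isSmoothProjective hX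
  have hf : Set.MapsTo (AlgPoints.mapContinuous (L := ℂ) N.blowDown) ({x}ᶜ : Set (ComplexPoints N.total))
      ({AlgPoints.mapContinuous (L := ℂ) N.blowDown x}ᶜ : Set (ComplexPoints X)) := by
    intro P hP h
    exact hP (hinj ⟨x, hx⟩ P h)
  exact map_fundamentalClass_ne_zero_of_homeomorph_nhds ℂ (μ N.isSmoothProjective_total)
    (AlgPoints.mapContinuous (L := ℂ) N.blowDown) hV hW e he hx hf

/-- **`σ_* 1 ≠ 0` in `H⁰(X(ℂ); ℂ)`** for the blow-down of a curve net (`σ_* 1 ⌢ [X(ℂ)] = σ(ℂ)_* [X̃(ℂ)]`,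
Fulton App. B (5), the tree's `capProduct_complexGysin_one`, and `map_blowDown_fundamentalClass_ne_zero`).
[cite: FultonYoungTableaux1997, Appendix B §B.1 (5)] -/
theorem complexGysin_blowDown_one_ne_zero {μ : OrientationFamily} (hμ : μ.HasPoincareDuality)
    (N : CurveNet m X) (hX : IsSmoothProjective (m + 1) X) :
    complexGysin μ N.isSmoothProjective_total hX N.blowDown
      (rfl : 0 + 2 * (m + 1) = 0 + 2 * (m + 1)) (singularCohomology.one ℂ (ComplexPoints N.total)) ≠ 0 := by
  intro h0
  apply map_blowDown_fundamentalClass_ne_zero N hX μ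
  have hcap := capProduct_complexGysin_one hμ N.isSmoothProjective_total hX N.blowDown (e := 0) rfl
  rw [← hcap]
  have h0' : complexGysin μ N.isSmoothProjective_total hX N.blowDown
      (show 0 + 2 * (m + 1) = 2 * 0 + 2 * (m + 1) by omega)
      (singularCohomology.one ℂ (ComplexPoints N.total)) = 0 := h0
  rw [h0', LinearMap.map_zero, LinearMap.zero_apply]

/-- **`σ_* σ^* = t • id` with `t ≠ 0`** on `H*(X(ℂ); ℂ)` for the blow-down `σ` of a curve net on a
smooth projective `X` of dimension `n = m + 1`: `σ_* 1 ∈ H⁰(X(ℂ); ℂ) = ℂ • 1` (`X(ℂ)` connected,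
`exists_eq_smul_one`) is `t • 1` with `t ≠ 0` (`complexGysin_blowDown_one_ne_zero`), and by the
projection formula `σ_* (σ^* c ∪ 1) = c ∪ σ_* 1` (Fulton App. B (6), `complexGysin_cup`).
[cite: FultonYoungTableaux1997, Appendix B §B.1 (6)] -/
theorem exists_complexGysin_blowDown_map_eq_smul {μ : OrientationFamily} (hμ : μ.HasPoincareDuality)
    (N : CurveNet m X) (hX : IsSmoothProjective (m + 1) X) :
    ∃ t : ℂ, t ≠ 0 ∧ ∀ (k : ℕ) (c : complexBetti X k),
      complexGysin μ N.isSmoothProjective_total hX N.blowDown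
        (rfl : k + 2 * (m + 1) = k + 2 * (m + 1)) (complexBetti.map N.blowDown k c) = t • c := by
  obtain ⟨t, ht⟩ := exists_eq_smul_one μ hX (complexGysin μ N.isSmoothProjective_total hX N.blowDown
    (rfl : 0 + 2 * (m + 1) = 0 + 2 * (m + 1)) (singularCohomology.one ℂ (ComplexPoints N.total)))
  refine ⟨t, ?_, fun k c ↦ ?_⟩
  · rintro rfl
    rw [zero_smul] at ht
    exact complexGysin_blowDown_one_ne_zero hμ N hX ht
  · have hcup := complexGysin_cup hμ N.isSmoothProjective_total hX N.blowDown (Nat.add_zero k)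
      (rfl : k + 2 * (m + 1) = k + 2 * (m + 1)) (rfl : 0 + 2 * (m + 1) = 0 + 2 * (m + 1))
      (Nat.add_zero k) c (singularCohomology.one ℂ (ComplexPoints N.total))
    rw [cupProduct_one] at hcup
    rw [hcup, ht, LinearMap.map_smul, cupProduct_one]

/-! ### Hodge classes of `X` are `σ_*` of Hodge classes of `X̃` -/

/-- **The cohomological half of `CurveNetExists`.** For a curve net `N` on a smooth projective
`X` of dimension `m + 1`, an orientation family `μ` with Poincaré duality and a Hodge model of the
total space `X̃`, the `ℂ`-span of the rational `(q,q)`-classes of `X` lies in `σ_*` of the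
`ℂ`-span of the rational `(q,q)`-classes of `X̃`: `c = σ_* (t⁻¹ • σ^* c)`
(`exists_complexGysin_blowDown_map_eq_smul`), and `σ^* c` is rational (`IsRationalClass.pullback`)
of Hodge type `(q,q)` (Voisin I §7.3.2, the tree's `IsOfHodgeType.map_of_le`).
[cite: VoisinHodgeI2002, §7.3.2] [cite: FultonYoungTableaux1997, Appendix B §B.1 (6)] -/
theorem span_hodgeClasses_le_map_complexGysin_blowDown {μ : OrientationFamily}
    (hμ : μ.HasPoincareDuality) (hX : IsSmoothProjective (m + 1) X) (N : CurveNet m X)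
    (B : HodgeModel (m + 1) N.total) (q : ℕ) :
    Submodule.span ℂ {c : complexBetti X (2 * q) |
        IsRationalClass c ∧ IsOfHodgeType (m + 1) X (2 * q) q q c} ≤
      (Submodule.span ℂ {c : complexBetti N.total (2 * q) |
          IsRationalClass c ∧ IsOfHodgeType (m + 1) N.total (2 * q) q q c}).map
        (complexGysin μ N.isSmoothProjective_total hX N.blowDown rfl) := by
  obtain ⟨t, ht, htc⟩ := exists_complexGysin_blowDown_map_eq_smul hμ N hX
  refine Submodule.span_le.2 ?_
  rintro c ⟨hc, hh⟩
  refine ⟨t⁻¹ • complexBetti.map N.blowDown (2 * q) c, ?_, ?_⟩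
  · exact Submodule.smul_mem _ _ (Submodule.subset_span
      ⟨hc.pullback _, hh.map_of_le N.isSmoothProjective_total hX B N.blowDown le_rfl⟩)
  · rw [LinearMap.map_smul, htc, smul_smul, inv_mul_cancel₀ ht, one_smul]

end Summit.HodgeConjecture.HodgeConjecture.Theorems

end
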